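import Summits.Ventures.CertifiedArithmetic.LowPrec.ExactDecision
import Summits.Ventures.CertifiedArithmetic.LowPrec.Conversion

/-!
# The conversion lattice: `F_X ⊆ F_Y` decided on `(P, L, M)` (Theorem D for conversions)

HONEST FRAMING (venture CertifiedArithmetic / cell `pub-lowprec`): certified error envelopes and
provably optimal rounding/accumulation schemes for low-precision formats under stated cost models;
every table by two implementations; no hardware or vendor claims.

A conversion `X → Y` is exact on EVERY input iff the value sets satisfy `F_X ⊆ F_Y`
(`Embeds X Y`). `Conversion.lean` (lean seat) proves the sufficient EMBEDDING CRITERION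
`MiniFloat.exists_toRat_eq_of_le` (`m_X ≤ m_Y`, `qexp_Y ≤ qexp_X`, `maxRat_X ≤ maxRat_Y`) and
29 named instances / witnessed non-instances, pair by pair. This file makes the criterion a
DECISION PROCEDURE, as `ExactDecision.lean` did for products and sums:

* `embedsTest X Y` — the integer test `P_X ≤ P_Y ∧ L_Y ≤ L_X ∧ M_X · 2^(L_X − L_Y) ≤ M_Y`
  (`M` = `maxScaled`);
* `embeds_iff_test` — for a source `X` passing `stdOperand` (precision `≥ 2`, the all-ones
  significand `2^P − 1` a value; every named format), `Embeds X Y ↔ embedsTest X Y = true`.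
  NECESSITY is the new half and uses three explicit witnesses, each a value of `X`: the quantum
  `2^L_X` (refutes `L_X < L_Y`), the all-ones significand `(2^P_X − 1) · 2^L_X` (odd, `P_X`
  bits: refutes `P_Y < P_X`) and `maxRat_X` (refutes `maxRat_Y < maxRat_X`) — via Corollary 0
  in the negative direction (`qexp_le_and_lt_of_toRat_eq`, ExactCriteria.lean). The hypothesis
  on `X` is needed: the format `⟨1, b, 1, 0⟩` has values `{0, ±q, ±2q}` and embeds in
  precision-1 formats although `P_X = 2`.
* `convExactNE_iff_test` — equivalently, `roundNE Y` fixes every value of `X` iff the test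
  passes;
* the COMPLETE LATTICE over the 13 distinct named records (`namedFormats` of
  ExactDecision.lean, `13² = 169` ordered pairs): `embeds_named_iff` —
  `Embeds X Y ↔ (X, Y) ∈ embedPairs`, a literal list of 67 pairs (54 strict) = implementation
  A's list (`code/enum/embed_decision.py`, which also checks the lattice by BRUTE FORCE
  `F_X ⊆ F_Y` value by value for every source but binary32, 210 name pairs, and verifies a
  witness for each of the 138 non-embeddings), certified equal to the kernel's filter of all
  pairs (`embedPairs_eq_filter`, `decide`).

Reading: every FP4/FP6/FP8/P3109 format embeds in binary16, bfloat16, binary32; binary16 and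
bfloat16 are incomparable and embed in binary32; below 16 bits the strict inclusions are exactly
`e2m1 ⊂` everything; `e3m2 ⊂ e4m3, e5m2, binary8p3, binary8p4, binary8p3f, binary8p4f` (not
`binary8p5`: `28 > 15`; not `e2m3`: quantum); `e2m3 ⊂ e4m3, binary8p4, binary8p5, binary8p4f`;
`e5m2 ⊂ binary8p3f = fnuz_e5m2` (but `e4m3 ⊄ binary8p4f = fnuz_e4m3`: `448 > 240`);
`binary8p3 ⊂ binary8p3f`, `binary8p4 ⊂ binary8p4f`; nothing else.
-/

namespace Summit.Ventures.CertifiedArithmetic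

open Literature.ComputerArithmetic.FloatingPoint
open Literature.ComputerArithmetic.FloatingPoint.Format
open Literature.ComputerArithmetic.FloatingPoint.MiniFloat

/-- VALUE-SET INCLUSION `F_φ ⊆ F_ψ`: every finite value of `φ` is the value of a finite datum
of `ψ` — the conversion `φ → ψ` is exact on every input. -/
def Embeds (φ ψ : Format) : Prop := ∀ x : MiniFloat φ, ∃ z : MiniFloat ψ, z.toRat = x.toRat

/-- THEOREM D (conversions), the integer test:
`P_X ≤ P_Y ∧ L_Y ≤ L_X ∧ M_X · 2^(L_X − L_Y) ≤ M_Y`. -/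
def embedsTest (φ ψ : Format) : Bool :=
  decide (φ.manBits ≤ ψ.manBits) && decide (ψ.qexp ≤ φ.qexp) &&
    decide (φ.maxScaled * 2 ^ (φ.qexp - ψ.qexp).toNat ≤ ψ.maxScaled)

/-! ## §1 The decision theorem -/

/-- Range clause in integers: under `L_Y ≤ L_X`,
`maxRat_X ≤ maxRat_Y ↔ M_X · 2^(L_X − L_Y) ≤ M_Y`. -/
theorem maxRat_le_maxRat_iff {φ ψ : Format} (h : ψ.qexp ≤ φ.qexp) :
    φ.maxRat ≤ ψ.maxRat ↔ φ.maxScaled * 2 ^ (φ.qexp - ψ.qexp).toNat ≤ ψ.maxScaled := by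
  unfold Format.maxRat Format.quantum
  exact natCast_mul_zpow_le_iff h

/-- SUFFICIENCY (= `MiniFloat.exists_toRat_eq_of_le` read through the test): a passing test embeds,
for every source format. [cite: IEEE7542019, §5.4.2] -/
theorem embeds_of_test {φ ψ : Format} (ht : embedsTest φ ψ = true) : Embeds φ ψ := by
  simp only [embedsTest, Bool.and_eq_true, decide_eq_true_eq] at ht
  obtain ⟨⟨hm, hq⟩, hM⟩ := ht
  exact fun x => exists_toRat_eq_of_le hm hq ((maxRat_le_maxRat_iff hq).2 hM) x

/-- NECESSITY, quantum clause: if the source has a nonzero value, an embedding forces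
`L_Y ≤ L_X` (witness: the quantum `2^L_X`). -/
theorem qexp_le_of_embeds {φ ψ : Format} (h1 : 1 ≤ φ.maxScaled) (h : Embeds φ ψ) :
    ψ.qexp ≤ φ.qexp := by
  obtain ⟨z, hz⟩ := h (ofScaled φ false 1 h1)
  rw [toRat_ofScaled_one h1] at hz
  exact (qexp_le_and_lt_of_toRat_eq z odd_one (by rw [hz]; simp)).1

/-- NECESSITY, range clause: an embedding forces `maxRat_X ≤ maxRat_Y` (witness: `maxRat_X`). -/
theorem maxRat_le_of_embeds {φ ψ : Format} (h : Embeds φ ψ) : φ.maxRat ≤ ψ.maxRat := by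
  obtain ⟨z, hz⟩ := h (ofScaled φ false φ.maxScaled le_rfl)
  rw [toRat_ofScaled_maxScaled] at hz
  have := abs_toRat_le_maxRat z
  rw [hz] at this
  exact le_trans (le_abs_self _) this

/-- NECESSITY, precision clause: if the all-ones significand `2^P_X − 1` is a value of the source,
an embedding forces `P_X ≤ P_Y` (it is odd with `P_X` bits; Corollary 0). -/
theorem manBits_le_of_embeds {φ ψ : Format} (hT : 2 ^ (φ.manBits + 1) - 1 ≤ φ.maxScaled)
    (h : Embeds φ ψ) : φ.manBits ≤ ψ.manBits := by
  have hlt : 2 ^ (φ.manBits + 1) - 1 < 2 ^ (φ.manBits + 1) := Nat.sub_lt (by positivity) one_pos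
  have hodd : Odd (2 ^ (φ.manBits + 1) - 1) :=
    Nat.Even.sub_odd Nat.one_le_two_pow (Nat.even_pow.mpr ⟨even_two, by omega⟩) odd_one
  obtain ⟨z, hz⟩ := h (ofScaled φ false _ hT)
  rw [toRat_ofScaled_of_lt_pow hlt hT] at hz
  have hc := (qexp_le_and_lt_of_toRat_eq z hodd hz).2
  by_contra hlt'
  have hpow : 2 ^ (ψ.manBits + 1) ≤ 2 ^ φ.manBits :=
    Nat.pow_le_pow_right (by norm_num) (by omega)
  have hsucc : 2 ^ (φ.manBits + 1) = 2 * 2 ^ φ.manBits := by rw [pow_succ]; ring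
  have hone : 1 ≤ 2 ^ φ.manBits := Nat.one_le_two_pow
  omega

/-- THEOREM D (conversions): for a standard source format, `F_X ⊆ F_Y` iff the integer test
passes — every conversion-exactness verdict is one evaluation of `embedsTest`. -/
theorem embeds_iff_test {φ ψ : Format} (hstd : stdOperand φ = true) :
    Embeds φ ψ ↔ embedsTest φ ψ = true := by
  simp only [stdOperand, Bool.and_eq_true, decide_eq_true_eq] at hstd
  refine ⟨fun h => ?_, embeds_of_test⟩
  have h2 : 2 ≤ 2 ^ (φ.manBits + 1) := by
    calc (2 : ℕ) = 2 ^ 1 := by norm_num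
      _ ≤ 2 ^ (φ.manBits + 1) := Nat.pow_le_pow_right (by norm_num) (by omega)
  have h1 : 1 ≤ φ.maxScaled := by omega
  have hq := qexp_le_of_embeds h1 h
  simp only [embedsTest, Bool.and_eq_true, decide_eq_true_eq]
  exact ⟨⟨manBits_le_of_embeds hstd.2 h, hq⟩,
    (maxRat_le_maxRat_iff hq).1 (maxRat_le_of_embeds h)⟩

/-- The refuter: a failing test on a standard source is a non-embedding (some conversion `X → Y`
is inexact). -/
theorem not_embeds_of_test {φ ψ : Format} (hstd : stdOperand φ = true)
    (ht : embedsTest φ ψ = false) : ¬ Embeds φ ψ := fun h => by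
  have := (embeds_iff_test hstd).1 h
  rw [ht] at this
  exact Bool.false_ne_true this

/-- CONVERSION FORM: round-to-nearest-even into `Y` fixes every value of `X` iff `F_X ⊆ F_Y`. -/
theorem convExactNE_iff_embeds (φ ψ : Format) :
    (∀ x : MiniFloat φ, (roundNE ψ x.toRat).toRat = x.toRat) ↔ Embeds φ ψ :=
  ⟨fun h x => ⟨roundNE ψ x.toRat, h x⟩, fun h x => toRat_roundNE_of_exists (h x)⟩

/-- THEOREM D (conversions), conversion form: for a standard source, `X → Y` under RNE is exact on
every input iff the integer test passes. -/
theorem convExactNE_iff_test {φ ψ : Format} (hstd : stdOperand φ = true) :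
    (∀ x : MiniFloat φ, (roundNE ψ x.toRat).toRat = x.toRat) ↔ embedsTest φ ψ = true :=
  (convExactNE_iff_embeds φ ψ).trans (embeds_iff_test hstd)

/-! ### Enumeration-free instances -/

/-- `e5m2 ⊂ fnuz_e5m2` (= `binary8p3f`: one more binade below, same top `57344`), but
`e4m3 ⊄ fnuz_e4m3` (= `binary8p4f`: `448 > 240`, the range clause). -/
example : Embeds E5M2 FnuzE5M2 ∧ ¬ Embeds E4M3 FnuzE4M3 :=
  ⟨embeds_of_test (by decide), not_embeds_of_test rfl (by decide)⟩

/-- `binary16` and `bfloat16` are incomparable (precision one way, quantum the other). -/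
example : ¬ Embeds Binary16 BFloat16 ∧ ¬ Embeds BFloat16 Binary16 :=
  ⟨not_embeds_of_test rfl (by decide), not_embeds_of_test rfl (by decide)⟩

/-! ## §2 The CONVERSION LATTICE of the named formats (implementation A's list, kernel-checked) -/

/-- All `13² = 169` ordered pairs `(X, Y)` of named format records. -/
def namedPairs : List (Format × Format) := namedFormats ×ˢ namedFormats

/-- Named components make a named pair. -/
theorem mem_namedPairs {X Y : Format} (hX : X ∈ namedFormats) (hY : Y ∈ namedFormats) :
    (X, Y) ∈ namedPairs := by
  simp only [namedPairs, List.mem_product]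
  exact ⟨hX, hY⟩

/-- Implementation A's list of the ordered pairs `(X, Y)` with `F_X ⊆ F_Y` (67 of 169;
54 strict). -/
def embedPairs : List (Format × Format) := [
  (E2M1, E2M1), (E2M1, E3M2), (E2M1, E2M3), (E2M1, E4M3), (E2M1, E5M2), (E2M1, Binary8p3),
  (E2M1, Binary8p4), (E2M1, Binary8p5), (E2M1, Binary8p3F), (E2M1, Binary8p4F), (E2M1, Binary16),
  (E2M1, BFloat16), (E2M1, Binary32), (E3M2, E3M2), (E3M2, E4M3), (E3M2, E5M2), (E3M2, Binary8p3),
  (E3M2, Binary8p4), (E3M2, Binary8p3F), (E3M2, Binary8p4F), (E3M2, Binary16), (E3M2, BFloat16),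
  (E3M2, Binary32), (E2M3, E2M3), (E2M3, E4M3), (E2M3, Binary8p4), (E2M3, Binary8p5),
  (E2M3, Binary8p4F), (E2M3, Binary16), (E2M3, BFloat16), (E2M3, Binary32), (E4M3, E4M3),
  (E4M3, Binary16), (E4M3, BFloat16), (E4M3, Binary32), (E5M2, E5M2), (E5M2, Binary8p3F),
  (E5M2, Binary16), (E5M2, BFloat16), (E5M2, Binary32), (Binary8p3, Binary8p3),
  (Binary8p3, Binary8p3F), (Binary8p3, Binary16), (Binary8p3, BFloat16), (Binary8p3, Binary32),
  (Binary8p4, Binary8p4), (Binary8p4, Binary8p4F), (Binary8p4, Binary16), (Binary8p4, BFloat16),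
  (Binary8p4, Binary32), (Binary8p5, Binary8p5), (Binary8p5, Binary16), (Binary8p5, BFloat16),
  (Binary8p5, Binary32), (Binary8p3F, Binary8p3F), (Binary8p3F, Binary16), (Binary8p3F, BFloat16),
  (Binary8p3F, Binary32), (Binary8p4F, Binary8p4F), (Binary8p4F, Binary16), (Binary8p4F, BFloat16),
  (Binary8p4F, Binary32), (Binary16, Binary16), (Binary16, Binary32), (BFloat16, BFloat16),
  (BFloat16, Binary32), (Binary32, Binary32)]

/-- A = B: the kernel's filter of all 169 pairs by `embedsTest` is implementation A's list, entry
for entry and in order. -/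
theorem embedPairs_eq_filter :
    namedPairs.filter (fun p => embedsTest p.1 p.2) = embedPairs := by
  decide

/-- THE LATTICE DECIDES CONVERSION EXACTNESS: for named `X, Y`, every value of `X` is a value of
`Y` iff `(X, Y)` is one of the 67 listed pairs. -/
theorem embeds_named_iff {X Y : Format} (hX : X ∈ namedFormats) (hY : Y ∈ namedFormats) :
    Embeds X Y ↔ (X, Y) ∈ embedPairs := by
  rw [embeds_iff_test (stdOperand_of_mem_namedFormats X hX), ← embedPairs_eq_filter,
    List.mem_filter]
  exact ⟨fun h => ⟨mem_namedPairs hX hY, h⟩, fun h => h.2⟩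

/-- Conversion form of the lattice: for named `X, Y`, RNE conversion `X → Y` is exact on every
input iff `(X, Y)` is listed. -/
theorem convExactNE_named_iff {X Y : Format} (hX : X ∈ namedFormats) (hY : Y ∈ namedFormats) :
    (∀ x : MiniFloat X, (roundNE Y x.toRat).toRat = x.toRat) ↔ (X, Y) ∈ embedPairs :=
  (convExactNE_iff_embeds X Y).trans (embeds_named_iff hX hY)

/-! ### Reading the lattice (one `decide` each) -/

/-- `e3m2` embeds in six 8-bit formats but not in `binary8p5` (`28 > 15`) nor in `e2m3`. -/
example : Embeds E3M2 Binary8p3 ∧ ¬ Embeds E3M2 Binary8p5 ∧ ¬ Embeds E3M2 E2M3 :=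
  ⟨(embeds_named_iff (by decide) (by decide)).2 (by decide),
    fun h => absurd ((embeds_named_iff (by decide) (by decide)).1 h) (by decide),
    fun h => absurd ((embeds_named_iff (by decide) (by decide)).1 h) (by decide)⟩

/-- The P3109 finite-domain records extend the IEEE-domain ones: `binary8p4 ⊂ binary8p4f`. -/
example : Embeds Binary8p4 Binary8p4F ∧ ¬ Embeds Binary8p4F Binary8p4 :=
  ⟨(embeds_named_iff (by decide) (by decide)).2 (by decide),
    fun h => absurd ((embeds_named_iff (by decide) (by decide)).1 h) (by decide)⟩

/-- Every conversion of an `e4m3` datum to `binary16` is exact (a lattice entry read as a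
conversion). -/
example (x : MiniFloat E4M3) : (roundNE Binary16 x.toRat).toRat = x.toRat :=
  (convExactNE_named_iff (by decide) (by decide)).2 (by decide) x

end Summit.Ventures.CertifiedArithmetic
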